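import Literature.NumberTheory.LFunctions.Zhang2022.Section8ProfileSjRanges
import Literature.NumberTheory.LFunctions.Zhang2022.Section8ProfileSjCalc
import Literature.NumberTheory.LFunctions.Zhang2022.Section8DipoleJets
import Literature.NumberTheory.LFunctions.Zhang2022.Section8FrontEnd810
import HarnessLib

/-!
# Zhang (2022) §8 (8.10)–(8.12) for profile data: the MAIN TERM of the gathering — «substituting `n = dr`» by (8.10),
# and the dictionary from the exact profile `Φ = jetEx·massEx` to DISPLAY #5's `𝔧_j·𝔪(bS j, bN j; ū)`

Topic `Literature/NumberTheory/LFunctions/Zhang2022` (Landau–Siegel audit tree; verdict-neutral). Y. Zhang, *Discrete mean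
estimates and the Landau–Siegel zero*, arXiv:2211.02515v1 (2022) [Zhang2022LandauSiegel] — **an unrefereed manuscript
under adjudication; nothing here asserts or denies its Theorems 1–2; no claim about Landau–Siegel zeros.** Cell
landau-siegel §D, crux K0 = stmt-Parity-20459 (row (S)), prover ls-knife-K0-p1 g2. Profile-data twin of
`Section8FrontEnd810.dedStep8u046_of` («It follows, by substituting `n = dr` …», p. 48):

* `mainDouble_eq` — `Σ_{n<K} Σ_{dr=n} w_j(d,r)A_j(n)B_j(d,r) = −Λ⁻²·L′(1,χ)²·Σ_{n<K} |χ(n)|λ₀ⱼ(n)φ(n)⁻¹F(n)` with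
  `F = engineProfile` (by (8.10), `Section8FrontEnd810.sum_antidiagonal_weight`, and `|χ|χ² = |χ|`) — the left side of the
  range-sum engine `Section8RangeEngine.weighted_sum_integral_eval`;
* `massEx_sub_k0mass`, `norm_prodProfile_sub_k0_le`, `norm_integral_prodProfile_sub_k0_le` — on `[0,θ]`,
  `Φ − 𝔧_j·𝔪 = (jetEx − 𝔧_j)·massEx + 𝔧_j·((σ−iπ bS)ū + (ν+π² bN)∫_z^θ ū)` (since `∫_θ^1 ū = 0`), hence
  `‖∫₀^θ Φ − ∫₀^θ 𝔧_j𝔪‖ ≤ θ·(ε_J K₀ + (B₁+πjB₀)(ε_σB₀ + ε_νB₀θ))` with the jet gaps `ε` of `Section8DipoleJets`;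
* `integral_k0_eq` — `∫₀¹ 𝔧_j𝔪 = ∫₀^θ 𝔧_j𝔪` for a short piece (`u = 0` on `[θ,∞)`, `u′ = 0` on `(θ,∞)`);
* `integral_prodProfile_split` — `∫₀^b Φ = ∫₀^θ Φ − ∫_b^θ Φ`, `‖∫_b^θ Φ‖ ≤ (θ−b)J₀K₀`.

## References
* Y. Zhang, arXiv:2211.02515v1 (2022), §8 (8.10)–(8.12) p. 48; §7 Prop 7.1. [cite: Zhang2022LandauSiegel, §8 (8.10)–(8.12) p.48]
-/

noncomputable section

open Complex Real MeasureTheory Set intervalIntegral Filter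
open scoped ComplexConjugate Topology

namespace Literature.NumberTheory.LFunctions.Zhang2022.DipoleRule

open Skeleton KnifeEdge

/-! ### «Substituting `n = dr`»: the main double sum collapses by (8.10) -/

/-- On the antidiagonal of `n`, `A_j(n)B_j(d,r) = Π(d,r)·(−χ(n)²Λ⁻²L′²·Φ(z_n))`. [cite: Zhang2022LandauSiegel, §8 p.48] -/
theorem psiMain_mul_antiMain_eq (c' : ℝ) {D : ℕ} [NeZero D] (χ : DirichletCharacter ℂ D) (j : ℕ)
    (u u' : ℝ → ℂ) (θ : ℝ) {n : ℕ} {p : ℕ × ℕ} (hp : p ∈ Nat.divisorsAntidiagonal n) :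
    psiMain c' D χ j u u' n * antiMain c' D χ j u u' θ p
      = PiW χ p.1 p.2 *
        (-(χ (n : ZMod D) ^ 2 * ((Real.log D ^ 9 : ℝ) : ℂ)⁻¹ ^ 2 * deriv χ.LFunction 1 ^ 2 *
          engineProfile (betaJ c' D j * Real.log D ^ 9) (sigmaJ c' D j) (nuJ c' D j) θ u u' (Real.log D ^ 9) n)) := by
  rw [Nat.mem_divisorsAntidiagonal] at hp
  unfold psiMain antiMain engineProfile prodProfile
  rw [hp.1]
  ring

/-- **THE COLLAPSE BY (8.10):** for a quadratic `χ` and any cut `K`,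
`Σ_{1≤n<K} Σ_{dr=n} w_j(d,r)·A_j(n)B_j(d,r) = −(Λ⁻²·L′(1,χ)²·Σ_{1≤n<K} |χ(n)|λ₀ⱼ(n)/φ(n)·F(n))`, `F = engineProfile`
(`Σ_{dr=n}|μ(r)|Π(d,r)/φ(r) = n/φ(n)`, `Section8FrontEnd810.eq810_holds`; `|χ(n)|χ(n)² = |χ(n)|`).
[cite: Zhang2022LandauSiegel, §8 (8.10) and display after it, p.48] -/
theorem mainDouble_eq (c' : ℝ) {D : ℕ} [NeZero D] (χ : DirichletCharacter ℂ D) (hq : χ.IsQuadratic) (j : ℕ)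
    (u u' : ℝ → ℂ) (θ : ℝ) (K : ℕ) :
    ∑ n ∈ Finset.Ico 1 K, ∑ p ∈ Nat.divisorsAntidiagonal n,
        sjWeight c' χ j p * (psiMain c' D χ j u u' n * antiMain c' D χ j u u' θ p)
      = -(((Real.log D ^ 9 : ℝ) : ℂ)⁻¹ ^ 2 * deriv χ.LFunction 1 ^ 2 *
          ∑ n ∈ Finset.Ico 1 K, (‖χ (n : ZMod D)‖ : ℂ) * lamZero c' D j n / (Nat.totient n : ℂ) *
            engineProfile (betaJ c' D j * Real.log D ^ 9) (sigmaJ c' D j) (nuJ c' D j) θ u u' (Real.log D ^ 9) n) := by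
  have h810 := Section8FrontEnd810.eq810_holds D χ hq
  rw [Finset.mul_sum, ← Finset.sum_neg_distrib]
  refine Finset.sum_congr rfl fun n hn => ?_
  rw [Finset.mem_Ico] at hn
  have hn0 : n ≠ 0 := by omega
  set G : ℂ := -(χ (n : ZMod D) ^ 2 * ((Real.log D ^ 9 : ℝ) : ℂ)⁻¹ ^ 2 * deriv χ.LFunction 1 ^ 2 *
    engineProfile (betaJ c' D j * Real.log D ^ 9) (sigmaJ c' D j) (nuJ c' D j) θ u u' (Real.log D ^ 9) n) with hG
  have hterm : ∀ p ∈ Nat.divisorsAntidiagonal n,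
      sjWeight c' χ j p * (psiMain c' D χ j u u' n * antiMain c' D χ j u u' θ p)
        = ((ArithmeticFunction.moebius p.2).natAbs : ℂ) * (‖χ ((p.1 * p.2 : ℕ) : ZMod D)‖ : ℂ) /
            (((p.1 * p.2 : ℕ) : ℂ) * (Nat.totient p.2 : ℂ)) * lamZero c' D j (p.1 * p.2) * PiW χ p.1 p.2 * G := by
    intro p hp
    rw [psiMain_mul_antiMain_eq c' χ j u u' θ hp, ← hG]
    unfold sjWeight
    ring
  rw [Finset.sum_congr rfl hterm, Section8FrontEnd810.sum_antidiagonal_weight χ c' j h810 hn0 G, hG]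
  have hsq := norm_mul_sq_of_isQuadratic hq (n : ZMod D)
  calc (‖χ (n : ZMod D)‖ : ℂ) * lamZero c' D j n / (Nat.totient n : ℂ) *
        -(χ (n : ZMod D) ^ 2 * ((Real.log D ^ 9 : ℝ) : ℂ)⁻¹ ^ 2 * deriv χ.LFunction 1 ^ 2 *
          engineProfile (betaJ c' D j * Real.log D ^ 9) (sigmaJ c' D j) (nuJ c' D j) θ u u' (Real.log D ^ 9) n)
      = -(((‖χ (n : ZMod D)‖ : ℂ) * χ (n : ZMod D) ^ 2) * lamZero c' D j n / (Nat.totient n : ℂ) *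
          (((Real.log D ^ 9 : ℝ) : ℂ)⁻¹ ^ 2 * deriv χ.LFunction 1 ^ 2 *
          engineProfile (betaJ c' D j * Real.log D ^ 9) (sigmaJ c' D j) (nuJ c' D j) θ u u' (Real.log D ^ 9) n)) := by
        ring
    _ = _ := by rw [hsq]; ring

/-! ### The dictionary `Φ ↔ 𝔧_j·𝔪(bS j, bN j; ū)` -/

variable {u u' : ℝ → ℂ} {θ : ℝ}

/-- A short piece continuous on `[0,θ]` and vanishing on `[θ,∞)` is continuous on `[0,1]` (`0 ≤ θ ≤ 1`).
[cite: Zhang2022LandauSiegel, §7 (7.2)] -/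
theorem continuousOn_Icc_one_of_short (hu : ContinuousOn u (Icc 0 θ)) (hvan : ∀ y : ℝ, θ ≤ y → u y = 0) :
    ContinuousOn u (Icc 0 1) := by
  have h2 : ContinuousOn u (Ici θ) := by
    refine (continuousOn_const (c := (0 : ℂ))).congr fun y hy => ?_
    exact hvan y hy
  have h := hu.union_of_isClosed h2 isClosed_Icc isClosed_Ici
  refine h.mono fun y hy => ?_
  by_cases hyθ : y ≤ θ
  · exact Or.inl ⟨hy.1, hyθ⟩
  · exact Or.inr (le_of_lt (not_le.mp hyθ))

/-- `∫_θ^1 ū = 0` for a short piece (`u = 0` on `[θ,∞)`, `θ ≤ 1`). [cite: Zhang2022LandauSiegel, §7 (7.2)] -/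
theorem integral_conj_tail_eq_zero (hvan : ∀ y : ℝ, θ ≤ y → u y = 0) (hθ1 : θ ≤ 1) :
    (∫ y in θ..1, conj (u y)) = 0 := by
  rw [← intervalIntegral.integral_zero (a := θ) (b := (1:ℝ))]
  refine intervalIntegral.integral_congr fun y hy => ?_
  rw [Set.uIcc_of_le hθ1] at hy
  simp [hvan y hy.1]

/-- **The mass-rule gap:** on `[0,θ]`, `massEx σ ν − 𝔪(s,N; ū) = (σ − iπs)ū(z) + (ν + π²N)∫_z^θ ū` (the tail `∫_θ^1 ū` vanishes).
[cite: Zhang2022LandauSiegel, §8 Lemma 8.4; Prop 7.1 pp.44–50] -/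
theorem massEx_sub_k0mass {σ ν : ℂ} {s N : ℝ} (hu : ContinuousOn u (Icc 0 θ)) (hvan : ∀ y : ℝ, θ ≤ y → u y = 0)
    (hθ0 : 0 ≤ θ) (hθ1 : θ ≤ 1) {z : ℝ} (hz : z ∈ Icc 0 θ) :
    massEx σ ν θ u u' z - k0mass s N (fun t => conj (u t)) (fun t => conj (u' t)) z
      = (σ - I * π * ((s : ℝ) : ℂ)) * conj (u z) + (ν + (π : ℂ) ^ 2 * ((N : ℝ) : ℂ)) * ∫ y in z..θ, conj (u y) := by
  have hc1 : ContinuousOn (fun y => conj (u y)) (Icc 0 1) :=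
    Complex.continuous_conj.comp_continuousOn (continuousOn_Icc_one_of_short hu hvan)
  have hzθ : IntervalIntegrable (fun y => conj (u y)) volume z θ :=
    ContinuousOn.intervalIntegrable (by rw [Set.uIcc_of_le hz.2]; exact hc1.mono (Icc_subset_Icc hz.1 hθ1))
  have hθ1' : IntervalIntegrable (fun y => conj (u y)) volume θ 1 :=
    ContinuousOn.intervalIntegrable (by rw [Set.uIcc_of_le hθ1]; exact hc1.mono (Icc_subset_Icc hθ0 le_rfl))
  have hsplit : (∫ y in z..1, conj (u y)) = ∫ y in z..θ, conj (u y) := by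
    rw [← intervalIntegral.integral_add_adjacent_intervals hzθ hθ1', integral_conj_tail_eq_zero hvan hθ1, add_zero]
  unfold massEx k0mass
  rw [hsplit]
  ring

/-- `‖𝔧_j(u;z)‖ ≤ B₁ + πjB₀`. [cite: Zhang2022LandauSiegel, §8 Lemma 8.2] -/
theorem norm_k0jet_le {j : ℕ} {z B₀ B₁ : ℝ} (h0 : ‖u z‖ ≤ B₀) (h1 : ‖u' z‖ ≤ B₁) :
    ‖k0jet j u u' z‖ ≤ B₁ + π * j * B₀ := by
  unfold k0jet
  calc ‖u' z + I * π * (j : ℂ) * u z‖ ≤ ‖u' z‖ + ‖I * π * (j : ℂ) * u z‖ := norm_add_le _ _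
    _ ≤ B₁ + π * j * B₀ := by
        rw [norm_mul, norm_mul, norm_mul, Complex.norm_I, one_mul, Complex.norm_real, Real.norm_of_nonneg Real.pi_pos.le,
          Complex.norm_natCast]
        gcongr

/-- **Pointwise gap `Φ − 𝔧_j𝔪` on `[0,θ]`:** with `‖jetEx − 𝔧_j‖ ≤ ε_J`, `‖σ − iπs‖ ≤ ε_σ`, `‖ν + π²N‖ ≤ ε_ν` and the profile
bounds `B₀, B₁`: `‖Φ(z) − 𝔧_j(z)𝔪(z)‖ ≤ ε_J(B₁ + ‖σ‖B₀ + ‖ν‖B₀θ) + (B₁ + πjB₀)(ε_σB₀ + ε_νB₀θ)`.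
[cite: Zhang2022LandauSiegel, §8 Lemmas 8.2/8.4; §2 (2.13)] -/
theorem norm_prodProfile_sub_k0_le {γ σ ν : ℂ} {j : ℕ} {s N : ℝ} (hu : ContinuousOn u (Icc 0 θ))
    (hvan : ∀ y : ℝ, θ ≤ y → u y = 0) (hθ0 : 0 ≤ θ) (hθ1 : θ ≤ 1) {B₀ B₁ εJ εσ εν : ℝ}
    (hB0 : ∀ y ∈ Icc 0 θ, ‖u y‖ ≤ B₀) (hB1 : ∀ y ∈ Icc 0 θ, ‖u' y‖ ≤ B₁)
    (hJ : ∀ y ∈ Icc 0 θ, ‖jetEx γ u u' y - k0jet j u u' y‖ ≤ εJ) (hσ : ‖σ - I * π * ((s : ℝ) : ℂ)‖ ≤ εσ)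
    (hν : ‖ν + (π : ℂ) ^ 2 * ((N : ℝ) : ℂ)‖ ≤ εν) {z : ℝ} (hz : z ∈ Icc 0 θ) :
    ‖prodProfile γ σ ν θ u u' z - k0jet j u u' z * k0mass s N (fun t => conj (u t)) (fun t => conj (u' t)) z‖
      ≤ εJ * (B₁ + ‖σ‖ * B₀ + ‖ν‖ * (B₀ * θ)) + (B₁ + π * j * B₀) * (εσ * B₀ + εν * (B₀ * θ)) := by
  have hB00 : 0 ≤ B₀ := (norm_nonneg _).trans (hB0 z hz)
  have hεσ : 0 ≤ εσ := (norm_nonneg _).trans hσ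
  have hεν : 0 ≤ εν := (norm_nonneg _).trans hν
  have hgap := massEx_sub_k0mass (σ := σ) (ν := ν) (s := s) (N := N) (u' := u') hu hvan hθ0 hθ1 hz
  set K := massEx σ ν θ u u' z with hK
  set Km := k0mass s N (fun t => conj (u t)) (fun t => conj (u' t)) z with hKm
  set J := jetEx γ u u' z with hJd
  set Jk := k0jet j u u' z with hJk
  have e : J * K - Jk * Km = (J - Jk) * K + Jk * (K - Km) := by ring
  have hKn : ‖K‖ ≤ B₁ + ‖σ‖ * B₀ + ‖ν‖ * (B₀ * θ) := norm_massEx_le (σ := σ) (ν := ν) hB0 hB1 hz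
  have hJkn : ‖Jk‖ ≤ B₁ + π * j * B₀ := norm_k0jet_le (hB0 z hz) (hB1 z hz)
  have hint : ‖∫ y in z..θ, conj (u y)‖ ≤ B₀ * θ := by
    have h1 : ‖∫ y in z..θ, conj (u y)‖ ≤ B₀ * |θ - z| := by
      refine intervalIntegral.norm_integral_le_of_norm_le_const fun y hy => ?_
      rw [Set.uIoc_of_le hz.2] at hy
      rw [Complex.norm_conj]
      exact hB0 y ⟨hz.1.trans hy.1.le, hy.2⟩
    rw [abs_of_nonneg (by linarith [hz.2])] at h1
    exact h1.trans (by nlinarith [hz.1])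
  have hgapn : ‖K - Km‖ ≤ εσ * B₀ + εν * (B₀ * θ) := by
    rw [hgap]
    calc ‖(σ - I * π * ((s : ℝ) : ℂ)) * conj (u z) + (ν + (π : ℂ) ^ 2 * ((N : ℝ) : ℂ)) * ∫ y in z..θ, conj (u y)‖
        ≤ ‖(σ - I * π * ((s : ℝ) : ℂ)) * conj (u z)‖ + ‖(ν + (π : ℂ) ^ 2 * ((N : ℝ) : ℂ)) * ∫ y in z..θ, conj (u y)‖ :=
          norm_add_le _ _
      _ ≤ εσ * B₀ + εν * (B₀ * θ) := by
          rw [norm_mul, norm_mul, Complex.norm_conj]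
          gcongr
          exact hB0 z hz
  have hJk0 : 0 ≤ B₁ + π * j * B₀ := (norm_nonneg _).trans hJkn
  unfold prodProfile
  rw [← hJd, ← hK, e]
  calc ‖(J - Jk) * K + Jk * (K - Km)‖ ≤ ‖(J - Jk) * K‖ + ‖Jk * (K - Km)‖ := norm_add_le _ _
    _ = ‖J - Jk‖ * ‖K‖ + ‖Jk‖ * ‖K - Km‖ := by rw [norm_mul, norm_mul]
    _ ≤ εJ * (B₁ + ‖σ‖ * B₀ + ‖ν‖ * (B₀ * θ)) + (B₁ + π * j * B₀) * (εσ * B₀ + εν * (B₀ * θ)) := by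
        gcongr
        · exact (norm_nonneg _).trans (hJ z hz)
        · exact hJ z hz

/-- **Integrated gap:** `‖∫₀^θ Φ − ∫₀^θ 𝔧_j𝔪‖ ≤ θ·(ε_J K₀ + (B₁+πjB₀)(ε_σB₀ + ε_νB₀θ))` — with the jet gaps of
`Section8DipoleJets` (`ε = O(c′α𝓛) = O(𝓛⁻⁸)`) this is `o(1)`. [cite: Zhang2022LandauSiegel, §8 (8.11)–(8.12); §2 (2.13)] -/
theorem norm_integral_prodProfile_sub_k0_le {γ σ ν : ℂ} {j : ℕ} {s N : ℝ} (hu : ContinuousOn u (Icc 0 θ))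
    (hvan : ∀ y : ℝ, θ ≤ y → u y = 0) (hθ0 : 0 ≤ θ) (hθ1 : θ ≤ 1) {B₀ B₁ εJ εσ εν : ℝ}
    (hB0 : ∀ y ∈ Icc 0 θ, ‖u y‖ ≤ B₀) (hB1 : ∀ y ∈ Icc 0 θ, ‖u' y‖ ≤ B₁)
    (hJ : ∀ y ∈ Icc 0 θ, ‖jetEx γ u u' y - k0jet j u u' y‖ ≤ εJ) (hσ : ‖σ - I * π * ((s : ℝ) : ℂ)‖ ≤ εσ)
    (hν : ‖ν + (π : ℂ) ^ 2 * ((N : ℝ) : ℂ)‖ ≤ εν) :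
    ‖∫ z in (0:ℝ)..θ, (prodProfile γ σ ν θ u u' z
        - k0jet j u u' z * k0mass s N (fun t => conj (u t)) (fun t => conj (u' t)) z)‖
      ≤ (εJ * (B₁ + ‖σ‖ * B₀ + ‖ν‖ * (B₀ * θ)) + (B₁ + π * j * B₀) * (εσ * B₀ + εν * (B₀ * θ))) * θ := by
  have h := intervalIntegral.norm_integral_le_of_norm_le_const (a := (0:ℝ)) (b := θ)
    (f := fun z => prodProfile γ σ ν θ u u' z - k0jet j u u' z * k0mass s N (fun t => conj (u t)) (fun t => conj (u' t)) z)
    (C := εJ * (B₁ + ‖σ‖ * B₀ + ‖ν‖ * (B₀ * θ)) + (B₁ + π * j * B₀) * (εσ * B₀ + εν * (B₀ * θ))) ?_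
  · rwa [sub_zero, abs_of_nonneg hθ0] at h
  · intro z hz
    rw [Set.uIoc_of_le hθ0] at hz
    exact norm_prodProfile_sub_k0_le hu hvan hθ0 hθ1 hB0 hB1 hJ hσ hν ⟨hz.1.le, hz.2⟩

/-- **`∫₀¹ 𝔧_j𝔪 = ∫₀^θ 𝔧_j𝔪` for a short piece** (`u = 0` on `[θ,∞)` and `u′ = 0` on `(θ,∞)` make `𝔧_j(u;z) = 0` for
`z > θ`). [cite: Zhang2022LandauSiegel, §7 (7.2); Prop 7.1 pp.44–50] -/
theorem integral_k0_eq {j : ℕ} {s N : ℝ} (hu : ContinuousOn u (Icc 0 θ)) (hu' : ContinuousOn u' (Icc 0 θ))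
    (hvan : ∀ y : ℝ, θ ≤ y → u y = 0) (hvan' : ∀ y : ℝ, θ < y → u' y = 0) (hθ0 : 0 ≤ θ) (hθ1 : θ ≤ 1) :
    (∫ z in (0:ℝ)..1, k0jet j u u' z * k0mass s N (fun t => conj (u t)) (fun t => conj (u' t)) z)
      = ∫ z in (0:ℝ)..θ, k0jet j u u' z * k0mass s N (fun t => conj (u t)) (fun t => conj (u' t)) z := by
  set f : ℝ → ℂ := fun z => k0jet j u u' z * k0mass s N (fun t => conj (u t)) (fun t => conj (u' t)) z with hf
  -- integrability on `[0,θ]` and `[θ,1]`: `f` is bounded and measurable there; we use continuity of the pieces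
  have hc1 : ContinuousOn (fun y => conj (u y)) (Icc 0 1) :=
    Complex.continuous_conj.comp_continuousOn (continuousOn_Icc_one_of_short hu hvan)
  have htail : ContinuousOn (fun z => ∫ t in z..1, conj (u t)) (Icc 0 1) := by
    have hint : IntegrableOn (fun x => conj (u x)) (Set.uIcc 0 1) volume := by
      rw [Set.uIcc_of_le zero_le_one]
      exact hc1.integrableOn_compact isCompact_Icc
    have h := intervalIntegral.continuousOn_primitive_interval_left hint
    rwa [Set.uIcc_of_le zero_le_one] at h
  -- on `(θ, 1]` the integrand vanishes
  have hzero : ∀ z : ℝ, θ < z → f z = 0 := by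
    intro z hz
    simp only [hf, k0jet, hvan z hz.le, hvan' z hz, mul_zero, add_zero, zero_mul]
  -- `∫_θ^1 f = 0`
  have h2 : (∫ z in θ..1, f z) = 0 := by
    rw [← intervalIntegral.integral_zero (a := θ) (b := (1:ℝ))]
    refine intervalIntegral.integral_congr_ae (Eventually.of_forall fun z hz => ?_)
    rw [Set.uIoc_of_le hθ1] at hz
    exact hzero z hz.1
  -- integrability of `f` on `[0,θ]` (continuous) and on `[θ,1]` (a.e. zero)
  have hK0 : ContinuousOn (fun z => k0mass s N (fun t => conj (u t)) (fun t => conj (u' t)) z) (Icc 0 θ) := by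
    unfold k0mass
    refine ((continuousOn_const.mul (htail.mono (Icc_subset_Icc le_rfl hθ1))).add
      (continuousOn_const.mul (Complex.continuous_conj.comp_continuousOn hu))).sub
      (Complex.continuous_conj.comp_continuousOn hu')
  have hJ0 : ContinuousOn (k0jet j u u') (Icc 0 θ) := by
    unfold k0jet; exact hu'.add (continuousOn_const.mul hu)
  have hi1 : IntervalIntegrable f volume 0 θ :=
    ContinuousOn.intervalIntegrable (by rw [Set.uIcc_of_le hθ0]; exact hJ0.mul hK0)
  have hi2 : IntervalIntegrable f volume θ 1 := by
    refine (intervalIntegrable_const (c := (0:ℂ)) (μ := volume) (a := θ) (b := 1)).congr ?_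
    rw [Set.uIoc_of_le hθ1]
    exact fun z hz => (hzero z hz.1).symm
  rw [← intervalIntegral.integral_add_adjacent_intervals hi1 hi2, h2, add_zero]

/-- **Splitting the main integral at `b ∈ [0,θ]`:** `∫₀^b Φ = ∫₀^θ Φ − ∫_b^θ Φ` and `‖∫_b^θ Φ‖ ≤ (θ − b)·J₀K₀`.
[cite: Zhang2022LandauSiegel, §8 (8.11) p.48] -/
theorem integral_prodProfile_split {γ σ ν : ℂ} (hθ0 : 0 ≤ θ) (hu : ContinuousOn u (Icc 0 θ))
    (hu' : ContinuousOn u' (Icc 0 θ)) {B₀ B₁ : ℝ} (hB0 : ∀ y ∈ Icc 0 θ, ‖u y‖ ≤ B₀)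
    (hB1 : ∀ y ∈ Icc 0 θ, ‖u' y‖ ≤ B₁) {b : ℝ} (hb : b ∈ Icc 0 θ) :
    (∫ z in (0:ℝ)..b, prodProfile γ σ ν θ u u' z)
        = (∫ z in (0:ℝ)..θ, prodProfile γ σ ν θ u u' z) - ∫ z in b..θ, prodProfile γ σ ν θ u u' z ∧
      ‖∫ z in b..θ, prodProfile γ σ ν θ u u' z‖
        ≤ (θ - b) * ((‖γ‖ * B₀ + B₁) * (B₁ + ‖σ‖ * B₀ + ‖ν‖ * (B₀ * θ))) := by
  have h0 : (0:ℝ) ∈ Icc 0 θ := ⟨le_rfl, hθ0⟩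
  have hθ : θ ∈ Icc 0 θ := ⟨hθ0, le_rfl⟩
  have i1 := intervalIntegrable_prodProfile (γ := γ) (σ := σ) (ν := ν) hθ0 hu hu' h0 hb
  have i2 := intervalIntegrable_prodProfile (γ := γ) (σ := σ) (ν := ν) hθ0 hu hu' hb hθ
  constructor
  · rw [← intervalIntegral.integral_add_adjacent_intervals i1 i2]; ring
  · have h := intervalIntegral.norm_integral_le_of_norm_le_const (a := b) (b := θ)
      (f := prodProfile γ σ ν θ u u') (C := (‖γ‖ * B₀ + B₁) * (B₁ + ‖σ‖ * B₀ + ‖ν‖ * (B₀ * θ))) ?_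
    · rw [abs_of_nonneg (by linarith [hb.2])] at h
      linarith
    · intro z hz
      rw [Set.uIoc_of_le hb.2] at hz
      exact norm_prodProfile_le (γ := γ) (σ := σ) (ν := ν) hB0 hB1 ⟨hb.1.trans hz.1.le, hz.2⟩

end Literature.NumberTheory.LFunctions.Zhang2022.DipoleRule

end
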